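import Summits.CriticalPhenomena.PercolationContinuityZ3.Theorems.Transplant.BoxProdZ2SeedKit
import Summits.CriticalPhenomena.PercolationContinuityZ3.Theorems.Transplant.BoxProdZ2LinkedFace
import Summits.CriticalPhenomena.PercolationContinuityZ3.Theorems.Transplant.KNLevelsEquivariance
import HarnessLib

/-!
# The Step-IV inputs `h1` (uniqueness zone) and `h2` (linked face) for the thick cubes of the `X □ ℤ²` seed kit, at every candidate contact
# (BLUEPRINT-I-PHI §1 rows "Lemma 7", "Lemma 9", "cube behind a contact"; §5 frames; the per-contact Step-IV input of p2's `targetLemma_of_kits`)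

builds on p205010 (kernel theorem, internal audit signed; external expert review pending) — nothing in this file uses p205010.
Lane `prim-bschramm`, seat `prim-bschramm-p3` (Φ3-prod / CubeInputs, agreed with p2-g2 08:09Z, lead 08:19Z); helper file
(`--supports stmt-CriticalPhenomena-4575 --as helper`).

The thick cube of the kit behind a macro contact `x = (w, y + σ e_i)` of a tube level is `kitCube = B_X(c, nF) × (v + Λ_M)` with
`c = c(w)` the retracted fibre centre and `v = v(P)` Kozma–Nitzan's planar cube centre.  With the uniform fat radius `ψ = ufatRadius hT V₀`
over a finite set `V₀` of fibre representatives and `nF := ψ M`, this cube is the image of the STANDARD fat prism `Λ^fat_M(τ) =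
B_X(τ, ψ M) × Λ_M` under the frame automorphism `(u, t) ↦ (γ⁻¹ u, t + v)` where `γ c = τ ∈ V₀` (quasi-transitivity).  Hence:
* §1 geometry: balls under automorphisms, KN's planar cube as a translate of `Λ_M`, a quarter face inside `U(P)`
  (`exists_orthantFace_image_subset_uface`, KN's `orthantFace_image_subset_ufaceX` at `d = 2`), the frame images of the fat prisms;
* §2 **standard estimates, uniform over `V₀`**: `exists_scales` — for `δ > 0`, `m₀` there are inner sizes `msel τ ≥ m₀` and a planar
  scale `M₀` such that for all `M ≥ M₀`, `τ ∈ V₀`, `g ∈ D₄`: `P_p(zone Λ^fat(τ) (msel τ) M) > 1 - δ` (p2's `UniqZone` on the fat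
  prisms, a.s. uniqueness `hU` as input) and `P_p(linkIn Λ^fat_M(τ) Λ^fat_{msel τ}(τ) (B_X(τ, ψ M) × piece g M)) > 1 - δ` (Lemma 9-prod);
* §3 **at a contact** (`stepIV_inputs_at`): for the level-`j` kit with `nF = ψ M`, `M ≥ M₀`, every candidate contact `x` gets the frame
  sequence `Λˣ i = frame(Λ^fat_i(τ))` with `Λˣ M = kitCube x`, and `P_p(zone Λˣ (msel τ) M) > 1 - δ`,
  `P_p(linkIn (kitCube x) (Λˣ (msel τ)) (kitFace x)) > 1 - δ` (equivariance `KNLevelsEquivariance` + face monotonicity).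
The transfer to the exploration's weighting `prodBernoulli W` (subbox + window) and the call of `KNLevels.stepIV_in` are left to the
target-lemma instance assembler (one line each: `IsSubbox.real_eq_bondPercolation`, `real_eq_of_determinedBy_window`).

[cite: KozmaNitzan2024, §4 Lemma 7 (p. 15), Lemma 9 (p. 16), pp. 19–21 ((21)–(25)) — the ℤ^d model] [cite: GrimmettPercolation1999, §7.2]
-/

noncomputable section

open MeasureTheory

namespace Summit.CriticalPhenomena.PercolationContinuityZ3.Theorems

namespace Transplant

namespace BoxProdZ2

open Literature.Probability.Percolation Literature.Probability.LatticeModels SimpleGraph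
open Literature.Probability.Percolation.KozmaNitzan
open Literature.Probability.Percolation.GM
open Literature.Barriers.CriticalPhenomena (graphBall graphBall_finite mem_graphBall_self graphBall_mono mem_graphBall_map)
open KNLevels

variable {W : Type} [DecidableEq W] (X : SimpleGraph W) [X.LocallyFinite]

/-! ## §1 Geometry: frames carry standard fat prisms onto the cubes behind the contacts -/

/-- Automorphisms of `X` map fibre balls onto fibre balls. [folklore] -/
theorem image_ballFin_iso (γ : X ≃g X) (x : W) (R : ℕ) : (ballFin X x R).image γ = ballFin X (γ x) R := by
  ext y
  rw [Finset.mem_image, mem_ballFin]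
  constructor
  · rintro ⟨y₀, hy₀, rfl⟩
    exact mem_graphBall_map γ ((mem_ballFin X).1 hy₀)
  · intro hy
    refine ⟨γ.symm y, (mem_ballFin X).2 ?_, γ.apply_symm_apply y⟩
    have := mem_graphBall_map γ.symm hy
    simpa using this

omit [DecidableEq W] [X.LocallyFinite] in
/-- Kozma–Nitzan's planar cube is the translate `v(P) + Λ_M`. [folklore] -/
theorem cube_eq_image_box (Lo Hi : Site 2) (M : ℕ) (i : Fin 2) (σ : ℤ) (y : Site 2) :
    cube Lo Hi M i σ y = (box 2 M).image fun t => t + vctr Lo Hi M i σ y := by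
  ext z
  rw [mem_cube_iff_sub_mem_box, Finset.mem_image]
  constructor
  · intro h; exact ⟨z - vctr Lo Hi M i σ y, h, sub_add_cancel _ _⟩
  · rintro ⟨t, ht, rfl⟩; rwa [add_sub_cancel_right]

omit [DecidableEq W] [X.LocallyFinite] in
/-- **A quarter face inside `U(P)`**: the translate by `v(P)` of the orthant face of `Λ_M` in direction `i` with sign `σ` (any transverse
sign) lies in Kozma–Nitzan's face `U(P)` (at `d = 2`; KN's `orthantFace_image_subset_ufaceX`). [cite: KozmaNitzan2024, §4 p. 20 ((23))] -/
theorem exists_orthantFace_image_subset_uface {Lo Hi : Site 2} {M : ℕ} {i : Fin 2} {σ : ℤ} {y : Site 2} (hW : WinHyp Lo Hi M i σ y) :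
    ∃ (a : Fin 2) (τ' : Fin 2 → ℤˣ), (orthantFace a τ' M).image (fun t => t + vctr Lo Hi M i σ y) ⊆ uface Lo Hi M i σ y := by
  set σu : ℤˣ := if σ = 1 then 1 else -1 with hσu
  have hσ : (σu : ℤ) = σ := by
    rcases hW.sign with hs | hs
    · rw [hσu, if_pos hs, hs]; rfl
    · rw [hσu, if_neg (by rw [hs]; norm_num), hs]; rfl
  refine ⟨i, fun _ => σu, fun u hu => ?_⟩
  obtain ⟨z, hz, rfl⟩ := Finset.mem_image.1 hu
  obtain ⟨hzbox, hza, -⟩ := mem_orthantFace.1 hz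
  rw [mem_uface_iff_cube hW]
  refine ⟨(mem_cube_iff_sub_mem_box).2 (by rwa [add_sub_cancel_right]), ?_⟩
  rw [Pi.add_apply, ← hσ]
  have hsq : (σu : ℤ) * (σu : ℤ) = 1 := by rcases Int.units_eq_one_or σu with h1 | h1 <;> simp [h1]
  have : z i = (σu : ℤ) * M := by
    calc z i = ((σu : ℤ) * (σu : ℤ)) * z i := by rw [hsq, one_mul]
      _ = (σu : ℤ) * ((σu : ℤ) * z i) := by ring
      _ = (σu : ℤ) * M := by rw [hza]
  rw [this]; ring

/-- **Frames carry standard fat prisms onto the translated fat prisms around `γ τ`.** [folklore] -/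
theorem image_frame_ufatSeq [Countable W] {p : unitInterval} (hT : TubeSubcritical X p) (V₀ : Finset W) (γ : X ≃g X) (v : Site 2)
    (τ : W) (n : ℕ) :
    (ufatSeq X hT V₀ τ n).image (prodFrameIso X γ v) = ballFin X (γ τ) (ufatRadius X hT V₀ n) ×ˢ (box 2 n).image (fun t => t + v) := by
  rw [ufatSeq, image_prodFrameIso_product, image_ballFin_iso]

/-! ## §2 The standard estimates, uniform over the finite set of representatives -/

/-- **The scales of Step I for the product cubes**: given a.s. uniqueness `hU`, `θ > 0`, `TubeSubcritical` and `δ > 0`, there are inner sizes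
`msel τ ≥ m₀` (`τ ∈ V₀`) and a planar scale `M₀ > msel τ` such that for all `M ≥ M₀`: the uniqueness zone of `(Λ^fat_{msel τ}(τ), Λ^fat_M(τ))`
and the link from `Λ^fat_{msel τ}(τ)` to every macro quarter-piece `B_X(τ, ψ M) × piece g M` inside `Λ^fat_M(τ)` each have
probability `> 1 - δ`. [cite: KozmaNitzan2024, §4 p. 17 (Step I: the scales m, M), Lemma 7, Lemma 9] -/
theorem exists_scales [Countable W] {Δ : ℕ} (hΔ : ∀ w, X.degree w ≤ Δ) (hX : X.Connected) {p : unitInterval} (hp1 : (p : ℝ) < 1)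
    {z : W × Site 2} (hθ : 0 < theta (X □ zdGraph 2) z p) (hT : TubeSubcritical X p)
    (hU : ∀ᵐ ω ∂(bondPercolation (X □ zdGraph 2) p), numInfiniteClusters ω ≤ 1)
    (V₀ : Finset W) {δ : ℝ} (hδ : 0 < δ) (m₀ : ℕ) :
    ∃ (msel : W → ℕ) (M₀ : ℕ), (∀ τ ∈ V₀, m₀ ≤ msel τ ∧ msel τ < M₀) ∧ ∀ M, M₀ ≤ M → ∀ τ ∈ V₀,
      1 - δ < (bondPercolation (X □ zdGraph 2) p).real (UniqZone.zone (X □ zdGraph 2) (ufatSeq X hT V₀ τ) (msel τ) M) ∧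
      ∀ g : HOct 2, 1 - δ < (bondPercolation (X □ zdGraph 2) p).real
        (linkIn (↑(ufatSeq X hT V₀ τ M)) (ufatSeq X hT V₀ τ (msel τ)) (ballFin X τ (ufatRadius X hT V₀ M) ×ˢ piece g M)) := by
  set k := Fintype.card (HOct 2) with hk
  have hk0 : k ≠ 0 := Fintype.card_ne_zero
  -- `η` with `η^{1/8} = δ/2`
  set η : ℝ := (δ / 2) ^ k with hη
  have hηpos : 0 < η := by positivity
  have hroot : η ^ ((k : ℝ)⁻¹) = δ / 2 := Real.pow_rpow_inv_natCast (by positivity) hk0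
  -- Lemma 9-prod at every representative
  have hL9 : ∀ τ ∈ V₀, ∃ m : ℕ, m₀ ≤ m ∧ ∃ n₁ : ℕ, m < n₁ ∧ ∀ n, n₁ ≤ n → ∀ g : HOct 2,
      1 - η ^ ((k : ℝ)⁻¹) ≤ (bondPercolation (X □ zdGraph 2) p).real
        (linkIn (↑(ufatSeq X hT V₀ τ n)) (ufatSeq X hT V₀ τ m) (ballFin X τ (ufatRadius X hT V₀ n) ×ˢ piece g n)) :=
    fun τ hτ => exists_forall_prob_linkIn_macroPiece X hΔ hX hp1 hθ hT hτ hηpos m₀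
  choose! msel hmsel n₁ hn₁ hlink using hL9
  -- the uniqueness zone at every representative, for the chosen inner sizes
  have hL7 : ∀ τ ∈ V₀, ∃ n₀ : ℕ, ∀ n, n₀ ≤ n →
      1 - δ < (bondPercolation (X □ zdGraph 2) p).real (UniqZone.zone (X □ zdGraph 2) (ufatSeq X hT V₀ τ) (msel τ) n) :=
    fun τ _ => UniqZone.exists_forall_le_lt_real_zone p hU (ufatSeq_nest X hT V₀ τ) (ufatSeq_monotone X hT V₀ τ)
      (ufatSeq_exhaust X hT V₀ hX τ) (msel τ) hδ
  choose! n₀ hn₀ using hL7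
  refine ⟨msel, V₀.sup n₁ + V₀.sup n₀ + 1, fun τ hτ => ⟨hmsel τ hτ, ?_⟩, fun M hM τ hτ => ⟨?_, fun g => ?_⟩⟩
  · have := hn₁ τ hτ; have := Finset.le_sup (f := n₁) hτ; omega
  · exact hn₀ τ hτ M (by have := Finset.le_sup (f := n₀) hτ; omega)
  · have h := hlink τ hτ M (by have := Finset.le_sup (f := n₁) hτ; omega) g
    rw [hroot] at h
    linarith

/-! ## §3 At a contact: the frame sequence, the cube, the face -/

/-- **The frame sequence of a contact**: the standard fat prisms around the representative `τ` carried by the frame `(u, t) ↦ (γ⁻¹ u, t + v)`.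
[cite: KozmaNitzan2024, §4 p. 21 (v(P) + Λ_M)] -/
def frameSeq [Countable W] {p : unitInterval} (hT : TubeSubcritical X p) (V₀ : Finset W) (γ : X ≃g X) (v : Site 2) (τ : W) (i : ℕ) :
    Finset (W × Site 2) :=
  (ufatSeq X hT V₀ τ i).image (prodFrameIso X γ.symm v)

/-- The frame sequence is monotone. [folklore] -/
theorem frameSeq_mono [Countable W] {p : unitInterval} (hT : TubeSubcritical X p) (V₀ : Finset W) (γ : X ≃g X) (v : Site 2) (τ : W) :
    Monotone (frameSeq X hT V₀ γ v τ) := fun _ _ h => Finset.image_subset_image (ufatSeq_monotone X hT V₀ τ h)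

/-- **The thick cube of a contact is the frame image of the standard fat prism** of planar scale `M`, when the kit's fibre radius is
`nF = ψ M`, the frame is `(γ⁻¹, v(P))` with `γ c = τ` (`c` the retracted fibre centre). [cite: KozmaNitzan2024, §4 p. 21] -/
theorem frameSeq_eq_kitCube [Countable W] {p : unitInterval} (hT : TubeSubcritical X p) (V₀ : Finset W) {xe : W} {Rw : ℕ}
    {Lo Hi : Site 2} {M : ℕ} {x : W × Site 2} (γ : X ≃g X) {τ : W} (hγ : γ (fibCtrT X xe Rw (ufatRadius X hT V₀ M) x.1) = τ) :
    frameSeq X hT V₀ γ (vctr Lo Hi M (pwin Lo Hi M x.2).1 (pwin Lo Hi M x.2).2.1 (pwin Lo Hi M x.2).2.2) τ M =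
      kitCube X xe Rw Lo Hi M (ufatRadius X hT V₀ M) x := by
  rw [frameSeq, image_frame_ufatSeq, kitCube, cube_eq_image_box]
  congr 1
  rw [← hγ, γ.symm_apply_apply]

/-- **A standard quarter-piece is carried into the thick face**: for the contact's planar data there is `g ∈ D₄` with
`frame(B_X(τ, ψ M) × piece g M) ⊆ kitFace x`. [cite: KozmaNitzan2024, §4 p. 20 ((23))] -/
theorem exists_piece_image_subset_kitFace [Countable W] {p : unitInterval} (hT : TubeSubcritical X p) (V₀ : Finset W) {xe : W} {Rw : ℕ}
    {Lo Hi : Site 2} {M : ℕ} {x : W × Site 2}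
    (hW : WinHyp Lo Hi M (pwin Lo Hi M x.2).1 (pwin Lo Hi M x.2).2.1 (pwin Lo Hi M x.2).2.2)
    (γ : X ≃g X) {τ : W} (hγ : γ (fibCtrT X xe Rw (ufatRadius X hT V₀ M) x.1) = τ) :
    ∃ g : HOct 2, (ballFin X τ (ufatRadius X hT V₀ M) ×ˢ piece g M).image
        (prodFrameIso X γ.symm (vctr Lo Hi M (pwin Lo Hi M x.2).1 (pwin Lo Hi M x.2).2.1 (pwin Lo Hi M x.2).2.2)) ⊆
      kitFace X xe Rw Lo Hi M (ufatRadius X hT V₀ M) x := by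
  obtain ⟨a, τ', hsub⟩ := exists_orthantFace_image_subset_uface hW
  refine ⟨(Equiv.swap 0 a, fun j => τ' (Equiv.swap 0 a j)), ?_⟩
  rw [← product_orthantFace_eq_piece, image_prodFrameIso_product, image_ballFin_iso, kitFace, ← hγ, γ.symm_apply_apply]
  exact Finset.product_subset_product le_rfl hsub

/-- **The Step-IV inputs at a candidate contact** (under `P_p` on `X □ ℤ²`): for the scales of `exists_scales` and the kit with fibre radius
`nF = ψ M`, `M ≥ M₀`, at every candidate contact `x` of a wide tube level the frame sequence `Λˣ` satisfies `Λˣ M = kitCube x`,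
`P_p(zone Λˣ (msel τ) M) > 1 - δ` and `P_p(linkIn (kitCube x) (Λˣ (msel τ)) (kitFace x)) > 1 - δ`, where `τ = γ c ∈ V₀`.
[cite: KozmaNitzan2024, §4 pp. 19–21 ((21)–(25))] -/
theorem stepIV_inputs_at [Countable W] {p : unitInterval} (hT : TubeSubcritical X p) (V₀ : Finset W) {δ : ℝ} {msel : W → ℕ} {M : ℕ}
    (hstd : ∀ τ ∈ V₀,
      1 - δ < (bondPercolation (X □ zdGraph 2) p).real (UniqZone.zone (X □ zdGraph 2) (ufatSeq X hT V₀ τ) (msel τ) M) ∧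
      ∀ g : HOct 2, 1 - δ < (bondPercolation (X □ zdGraph 2) p).real
        (linkIn (↑(ufatSeq X hT V₀ τ M)) (ufatSeq X hT V₀ τ (msel τ)) (ballFin X τ (ufatRadius X hT V₀ M) ×ˢ piece g M)))
    {xe : W} {Rw : ℕ} {lo hi : Site 2} {j : ℕ} (hwide : ∀ k, (lo - ((j : ℕ) : Site 2)) k + 2 * M + 2 ≤ (hi + ((j : ℕ) : Site 2)) k)
    {x : W × Site 2} (hx : x ∈ outerBoundary (tubeGraph X (ballFin X xe Rw)) (tubeLevel (ballFin X xe Rw) lo hi j))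
    (γ : X ≃g X) (hγ : γ (fibCtrT X xe Rw (ufatRadius X hT V₀ M) x.1) ∈ V₀) :
    let v := vctr (lo - ((j : ℕ) : Site 2)) (hi + ((j : ℕ) : Site 2)) M (pwin (lo - ((j : ℕ) : Site 2)) (hi + ((j : ℕ) : Site 2)) M x.2).1
      (pwin (lo - ((j : ℕ) : Site 2)) (hi + ((j : ℕ) : Site 2)) M x.2).2.1 (pwin (lo - ((j : ℕ) : Site 2)) (hi + ((j : ℕ) : Site 2)) M x.2).2.2
    let τ := γ (fibCtrT X xe Rw (ufatRadius X hT V₀ M) x.1)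
    frameSeq X hT V₀ γ v τ M = kitCube X xe Rw (lo - ((j : ℕ) : Site 2)) (hi + ((j : ℕ) : Site 2)) M (ufatRadius X hT V₀ M) x ∧
      1 - δ < (bondPercolation (X □ zdGraph 2) p).real (UniqZone.zone (X □ zdGraph 2) (frameSeq X hT V₀ γ v τ) (msel τ) M) ∧
      1 - δ < (bondPercolation (X □ zdGraph 2) p).real
        (linkIn (↑(kitCube X xe Rw (lo - ((j : ℕ) : Site 2)) (hi + ((j : ℕ) : Site 2)) M (ufatRadius X hT V₀ M) x))
          (frameSeq X hT V₀ γ v τ (msel τ)) (kitFace X xe Rw (lo - ((j : ℕ) : Site 2)) (hi + ((j : ℕ) : Site 2)) M (ufatRadius X hT V₀ M) x)) := by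
  intro v τ
  obtain ⟨-, hW, -⟩ := kit_contact hwide hx
  obtain ⟨hzone, hlink⟩ := hstd τ hγ
  have hcube := frameSeq_eq_kitCube X hT V₀ (xe := xe) (Rw := Rw) (Lo := lo - ((j : ℕ) : Site 2)) (Hi := hi + ((j : ℕ) : Site 2))
    (M := M) (x := x) γ (τ := τ) rfl
  refine ⟨hcube, ?_, ?_⟩
  · -- the uniqueness zone, carried by the frame
    have h := real_zone_image_iso (G := X □ zdGraph 2) (prodFrameIso X γ.symm v) p (ufatSeq X hT V₀ τ) (msel τ) M
    change 1 - δ < (bondPercolation (X □ zdGraph 2) p).real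
      (UniqZone.zone (X □ zdGraph 2) (fun i => (ufatSeq X hT V₀ τ i).image (prodFrameIso X γ.symm v)) (msel τ) M)
    rw [h]; exact hzone
  · -- the linked quarter-piece, carried by the frame, inside the thick face
    obtain ⟨g, hg⟩ := exists_piece_image_subset_kitFace X hT V₀ (xe := xe) (Rw := Rw) (Lo := lo - ((j : ℕ) : Site 2))
      (Hi := hi + ((j : ℕ) : Site 2)) hW γ (τ := τ) rfl
    have h := real_linkIn_image_iso (G := X □ zdGraph 2) (prodFrameIso X γ.symm v) p (ufatSeq X hT V₀ τ M) (ufatSeq X hT V₀ τ (msel τ))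
      (ballFin X τ (ufatRadius X hT V₀ M) ×ˢ piece g M)
    have hmono := linkIn_mono (U := (↑((ufatSeq X hT V₀ τ M).image (prodFrameIso X γ.symm v)) : Set (W × Site 2)))
      (S := (ufatSeq X hT V₀ τ (msel τ)).image (prodFrameIso X γ.symm v)) le_rfl le_rfl hg
    rw [← hcube, frameSeq]
    refine (hlink g).trans_le ?_
    rw [← h]
    exact measureReal_mono hmono (measure_ne_top _ _)

end BoxProdZ2

end Transplant

end Summit.CriticalPhenomena.PercolationContinuityZ3.Theorems

end
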